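import Literature.NumberTheory.Automorphic.Liu2021.ThetaLiftFromLineMeets
import Literature.NumberTheory.Weil1964.AdelicSchrodingerConjCont
import HarnessLib

/-!
# Complex conjugate of the line theta kernel: `conj θ_Φ(x, q) = Θ(ω_{−T}((s(x⁻¹,q⁻¹))ᶜ) Φ̄)` — organ (O44c), model level

Track B ∕ hLiu418 = stmt-HodgeConjecture-24832, line `K2_Liu_CurveThetaSigs`, unit U6 (the s5 seam), socket #44∕45 `sig_K2LiuUndoublingSeparation`,
organ (O44c) «conj-symmetry of line theta kernels» (LEAD F0P6-plan GO 2026-09-03 23:34Z); seat `hodgecm-mathlib-K2Liu-p03` (g2).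
FIRST LAYER (model level, this file): for the letter's ★ `Liu2021.lineThetaKernelDatum L N e₁ dV hdV hdV0 μ hμ a hρ` (the theta kernel of the pair
`U(diag dV) × U(⟨a⟩)` at the `μ`-attached splitting `s = chiSplittingLine …`, Gram `T = adelicGram e₁ (diag dV) (T_W a)`), the complex conjugate
of the kernel at `(x Γ_U, q Γ)` is the theta DISTRIBUTION of the conjugate test function `Φ̄` (★ `piSchwartzBruhatConj`) under the Weil
representation of the NEGATED model `W_{−T}` at the conjugate element `(s(x⁻¹, q⁻¹))ᶜ` (★ `adelicMpContConj : Mp_ψ(W_T)ᶜᵒⁿᵗ ≃* Mp_ψ(W_{−T})ᶜᵒⁿᵗ`):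
`conj θ_Φ(x, q) = Θ(ω_{−T}((s(x⁻¹,q⁻¹))ᶜ) Φ̄)` — ★ `thetaDist_omega_adelicMpContConj` («`Θ(ω_{−T}(pᶜ) Φ̄) = conj Θ(ω_T(p) Φ)`»,
[Li1992, (11)–(15) pp. 181–182]: «`ω*` is the same as `ω_{ψ̄}`»; [MoeglinVignerasWaldspurger1987, Chap. 2 II.1]) read through ★
`thetaKernelDatum_thetaFun_mk`. The SECOND LAYER (identifying `h ↦ (s_{λ,a}(h))ᶜ` with the `λ⁻¹`-attached splitting of the negated line `⟨−a⟩`,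
whence `conj θ_{Φ,λ,a} = θ_{Φ̄,λ⁻¹,−a}`) is the splitting-level organ (c1) of the seat's report (★ `AdelicMetaplecticFinRepConj.splittingConj`,
★ `AdelicMetaplecticRationalLiftConj`), not in this file.

* `conj_lineThetaKer_mk` — the model-level conjugation formula.

No definition, no instance, no named fact; axioms ⊆ {propext, Classical.choice, Quot.sound}.

## References
* J.-S. Li, *Non-vanishing theorems for the cohomology of certain arithmetic quotients*, J. reine angew. Math. 428 (1992), (11)–(15) pp. 181–182 [Li1992].
* C. Mœglin, M.-F. Vignéras, J.-L. Waldspurger, *Correspondances de Howe sur un corps p-adique*, LNM 1291 (1987), Chap. 2 II.1 [MoeglinVignerasWaldspurger1987].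
* M. Harris, S. Kudla, W. J. Sweet, *Theta dichotomy for unitary groups*, J. AMS 9 (1996), §1 Lem. 1.1, (1.30) [HarrisKudlaSweet1996].

HONEST LABEL: HC_CM is proved only modulo the 7 printed citations (2 remaining named inputs: hLiu418 =
stmt-HodgeConjecture-24832, h413 = stmt-HodgeConjecture-24833) until rung 0 closes; this helper moves no counter.
-/

noncomputable section

set_option autoImplicit false

set_option linter.dupNamespace false

open NumberField MeasureTheory IsDedekindDomain
open scoped Matrix ComplexOrder

namespace Summit.HodgeConjecture.HodgeConjecture.Cruxes.HLiu418.K2LiuLineThetaKernelConj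

open _root_.MeasureTheory
open Literature.NumberTheory.Automorphic Literature.NumberTheory.Automorphic.UnitaryGroup
open Literature.NumberTheory.Automorphic.UnitaryGroup.CotangentForms
open Literature.NumberTheory.Automorphic.IdeleClassGroup
open Literature.NumberTheory.Automorphic.Liu2021
open Literature.NumberTheory.Automorphic.Liu2021.Def411WeilCarriers
open Literature.NumberTheory.Automorphic.Liu2021.Def411WeilCarriersDoubling
open Literature.NumberTheory.GelbartRogawski1991 Literature.NumberTheory.GelbartRogawski1991.UnitaryDualPair
open Literature.NumberTheory.Weil1964 Literature.NumberTheory.Weil1964.ThetaKernelDatum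
open Literature.RepresentationTheory.Liu2021

variable (L : Type) [Field L] [NumberField L] [IsCMField L] (N : ℕ)
  {n' : ℕ} (e₁ : Fin N × Fin 1 ≃ Fin n') (dV : Fin N → L) (hdV : ∀ i, IsCMField.complexConj L (dV i) = dV i)
  (hdV0 : ∀ i, dV i ≠ 0)

/-- **`conj θ_Φ(x, q) = Θ(ω_{−T}((s(x⁻¹, q⁻¹))ᶜ) Φ̄)`** for the line theta kernel ★ `lineThetaKernelDatum` (model-level conjugation law:
★ `thetaKernelDatum_thetaFun_mk` + ★ `thetaDist_omega_adelicMpContConj`; `T = adelicGram e₁ (diag dV) (T_W a)`, `s` the `μ`-attached pair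
splitting ★ `pairSplitting … (chiSplittingLine …)`, `Φ̄ = piSchwartzBruhatConj Φ`, `pᶜ = adelicMpContConj p`).
[cite: Li1992, (11)–(15) pp. 181–182] [cite: MoeglinVignerasWaldspurger1987, Chap. 2 II.1] [cite: HarrisKudlaSweet1996, §1 Lem. 1.1] -/
theorem conj_lineThetaKer_mk (μ : Literature.NumberTheory.Automorphic.IdeleClassGroup L →ₜ* Circle) (hμ : IsConjugateSymplectic L μ)
    (a : (↥(maximalRealSubfield L))ˣ)
    (hρ : HasThetaMajorants fun
      (p : ↥(UnitaryGroup.adelic (↥(maximalRealSubfield L)) L (IsCMField.complexConj L) N (Matrix.diagonal dV)) ×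
        ↥(UnitaryGroup.adelic (↥(maximalRealSubfield L)) L (IsCMField.complexConj L) 1 (JW (↥(maximalRealSubfield L)) L a)))
      (Φ : piSchwartzBruhat (↥(maximalRealSubfield L)) (Fin n')) =>
        pairRep (↥(maximalRealSubfield L)) L (IsCMField.complexConj L) N 1 e₁ (Matrix.diagonal dV) (JW (↥(maximalRealSubfield L)) L a)
          (chiSplittingLine L e₁ dV hdV hdV0 (toHeckeCharacter L μ) (isUnitary_toHeckeCharacter L μ)
            ((isOscillatorChar_toHeckeCharacter_iff μ).mpr hμ) (TW (↥(maximalRealSubfield L)) a)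
            (isUnit_det_TW (↥(maximalRealSubfield L)) a) (JW (↥(maximalRealSubfield L)) L a) (JW_eq (↥(maximalRealSubfield L)) L a))
          p Φ)
    (Φ : piSchwartzBruhat (↥(maximalRealSubfield L)) (Fin n'))
    (x : ↥(UnitaryGroup.adelic (↥(maximalRealSubfield L)) L (IsCMField.complexConj L) N (Matrix.diagonal dV)))
    (q : ↥(UnitaryGroup.adelic (↥(maximalRealSubfield L)) L (IsCMField.complexConj L) 1 (JW (↥(maximalRealSubfield L)) L a))) :
    starRingEnd ℂ ((lineThetaKernelDatum L N e₁ dV hdV hdV0 μ hμ a hρ).thetaKer Φ (QuotientGroup.mk x, QuotientGroup.mk q)) =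
      thetaDistLM (↥(maximalRealSubfield L)) (Fin n')
        (adelicMpCont.omega (↥(maximalRealSubfield L)) (Fin n')
          (-(adelicGram (↥(maximalRealSubfield L)) e₁ (realDiagonal L dV hdV) (TW (↥(maximalRealSubfield L)) a)))
          (adelicMpContConj (↥(maximalRealSubfield L)) (Fin n')
            (adelicGram (↥(maximalRealSubfield L)) e₁ (realDiagonal L dV hdV) (TW (↥(maximalRealSubfield L)) a))
            (pairSplitting (↥(maximalRealSubfield L)) L (IsCMField.complexConj L) N 1 e₁ (Matrix.diagonal dV)
              (JW (↥(maximalRealSubfield L)) L a)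
              (chiSplittingLine L e₁ dV hdV hdV0 (toHeckeCharacter L μ) (isUnitary_toHeckeCharacter L μ)
                ((isOscillatorChar_toHeckeCharacter_iff μ).mpr hμ) (TW (↥(maximalRealSubfield L)) a)
                (isUnit_det_TW (↥(maximalRealSubfield L)) a) (JW (↥(maximalRealSubfield L)) L a) (JW_eq (↥(maximalRealSubfield L)) L a))
              (x⁻¹, q⁻¹)))
          (piSchwartzBruhatConj (↥(maximalRealSubfield L)) (Fin n') Φ)) := by
  have h1 := ThetaKernelDatum.thetaKer_mk (lineThetaKernelDatum L N e₁ dV hdV hdV0 μ hμ a hρ) Φ x q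
  have h2 := ThetaKernelDatum.thetaFun_apply (lineThetaKernelDatum L N e₁ dV hdV hdV0 μ hμ a hρ) Φ (x, q)
  have h3 : (lineThetaKernelDatum L N e₁ dV hdV hdV0 μ hμ a hρ).thetaFun Φ (x, q) =
      thetaDistLM (↥(maximalRealSubfield L)) (Fin n')
        (adelicMpCont.omega (↥(maximalRealSubfield L)) (Fin n')
          (adelicGram (↥(maximalRealSubfield L)) e₁ (realDiagonal L dV hdV) (TW (↥(maximalRealSubfield L)) a))
          (pairSplitting (↥(maximalRealSubfield L)) L (IsCMField.complexConj L) N 1 e₁ (Matrix.diagonal dV)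
            (JW (↥(maximalRealSubfield L)) L a)
            (chiSplittingLine L e₁ dV hdV hdV0 (toHeckeCharacter L μ) (isUnitary_toHeckeCharacter L μ)
              ((isOscillatorChar_toHeckeCharacter_iff μ).mpr hμ) (TW (↥(maximalRealSubfield L)) a)
              (isUnit_det_TW (↥(maximalRealSubfield L)) a) (JW (↥(maximalRealSubfield L)) L a) (JW_eq (↥(maximalRealSubfield L)) L a))
            (x⁻¹, q⁻¹)) Φ) :=
    thetaKernelDatum_thetaFun_mk (↥(maximalRealSubfield L)) L (IsCMField.complexConj L) N 1 e₁ (Matrix.diagonal dV)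
      (JW (↥(maximalRealSubfield L)) L a) (complexConj_imagUnit L) (imagUnit_ne_zero L) (imagUnit_mul_self L)
      (realDiagonal_isSymm L dV hdV) (isSymm_TW (↥(maximalRealSubfield L)) a) (isUnit_det_realDiagonal L dV hdV hdV0)
      (isUnit_det_TW (↥(maximalRealSubfield L)) a) (realDiagonal_map L dV hdV).symm (JW_eq (↥(maximalRealSubfield L)) L a)
      (isCompatible_chiSplittingLine L e₁ dV hdV hdV0 (toHeckeCharacter L μ) (isUnitary_toHeckeCharacter L μ)
        ((isOscillatorChar_toHeckeCharacter_iff μ).mpr hμ) (TW (↥(maximalRealSubfield L)) a) (isSymm_TW (↥(maximalRealSubfield L)) a)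
        (isUnit_det_TW (↥(maximalRealSubfield L)) a) (JW (↥(maximalRealSubfield L)) L a) (JW_eq (↥(maximalRealSubfield L)) L a))
      hρ Set.univ (fun _ _ _ => Set.mem_univ _) Φ x q
  have h4 := congrArg (starRingEnd ℂ) (h1.trans (h2.symm.trans h3))
  rw [thetaDistLM_apply] at h4
  rw [thetaDistLM_apply, thetaDist_omega_adelicMpContConj]
  exact h4

end Summit.HodgeConjecture.HodgeConjecture.Cruxes.HLiu418.K2LiuLineThetaKernelConj

end
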